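import Literature.Geometry.Symplectic.JSphereLocalFoliationFromTransverseFamily
import Literature.Geometry.Manifold.InjOnLocalDiffeomorphInverse
import Literature.Geometry.Symplectic.LeafCoordinateComplexLinearisation
import HarnessLib

/-!
# The leaf function of a smooth family of planes near a compact core of a leaf

Support theorems (no named facts, D-0026) for
`Literature.Geometry.Symplectic.jPlanePencil_localFamily_homotopySphere`
(`JPlanePencilLocalFamily.lean`; C. Wendl, *Holomorphic Curves in Low Dimensions* (2018),
Prop. 2.53 with `m = 1`, for homotopy 4-spheres).

Wendl, proof of Prop. 2.53 (p. 66): the kernel of the normal Cauchy–Riemann operator consists of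
nowhere-vanishing sections — "the 'linearization' of the statement that the curves near `u`
foliate an open subset", i.e. the evaluation map `Φ (b', ξ) = Floc b' ξ` of the family is an
immersion. This file turns that immersive family (the ANALYTIC output, here a hypothesis) into a
LEAF FUNCTION near any compact core of a leaf, the form in which the leaves enter positivity of
intersections (`positivityOfIntersections_leafCoordinate`) and the homological intersection
count (`sphere_zeroSetIndex_factorsThroughHomology_of_isClosed`):

* `exists_injOn_prod_ball` — an immersive `Φ : ℂ × ℂ → X⁴`, smooth on `ball b δ × ℂ` with
  `Φ (b, ·)` injective, is injective on `ball b δ' × ball 0 R` for some `δ' > 0` (local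
  injectivity at immersion points, `exists_mem_nhds_injOn`, spread over the compact slice
  `{b} × closedBall 0 R` by `Set.InjOn.exists_isOpen_superset` and the tube lemma);
* on such a box `D`: `Φ '' D` is open, `Φ⁻¹` is smooth on it
  (`contMDiffOn_invFunOn_of_bijective_mfderiv`, Lee 2013 Thm. 4.5), and the **leaf function**
  `coreLeafFn Φ D = pr₁ ∘ Φ⁻¹` is smooth with `coreLeafFn Φ D (Φ q) = q.1`
  (`coreLeafFn_apply`), its level sets are the leaves (`coreLeafFn_levelSet`), and its
  differential satisfies `dA ∘ dΦ = pr₁` (`mfderiv_coreLeafFn_comp`): it is surjective and kills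
  the tangent planes of the leaves (`surjective_mfderiv_coreLeafFn`,
  `mfderiv_coreLeafFn_slice_eq_zero`).

## References

* C. Wendl, *Holomorphic Curves in Low Dimensions*, LNM 2216, Springer (2018), Prop. 2.53 (proof,
  p. 66). [Wendl2018]
* J. M. Lee, *Introduction to Smooth Manifolds*, 2nd ed. (2013), Thm. 4.5. [LeeSmoothManifolds2013]
-/

noncomputable section

open scoped Manifold ContDiff Topology
open Set Function Filter Metric

namespace Literature.Geometry.Symplectic

section Core

variable {X : Type} [TopologicalSpace X] [ChartedSpace (EuclideanSpace ℝ (Fin 4)) X]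
  [IsManifold (𝓡 4) ∞ X] {Φ : ℂ × ℂ → X} {b : ℂ} {δ : ℝ}

omit [IsManifold (𝓡 4) ∞ X] in
/-- **Injectivity near a compact core of a leaf.** An immersive family `Φ`, smooth on
`ball b δ × ℂ` with injective central slice `Φ (b, ·)`, is injective on a box
`ball b δ' × ball 0 R`. [cite: Wendl2018, Prop. 2.53 (proof, p. 66)] -/
theorem exists_injOn_prod_ball [T2Space X] (hδ : 0 < δ)
    (hΦ : ContMDiffOn 𝓘(ℝ, ℂ × ℂ) (𝓡 4) ∞ Φ (ball b δ ×ˢ univ))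
    (himm : ∀ q ∈ ball b δ ×ˢ (univ : Set ℂ), Injective (mfderiv 𝓘(ℝ, ℂ × ℂ) (𝓡 4) Φ q))
    (hinj : Injective fun ξ : ℂ => Φ (b, ξ)) (R : ℝ) :
    ∃ δ' : ℝ, 0 < δ' ∧ δ' ≤ δ ∧ InjOn Φ (ball b δ' ×ˢ ball 0 R) := by
  have hopen : IsOpen (ball b δ ×ˢ (univ : Set ℂ)) := isOpen_ball.prod isOpen_univ
  set s : Set (ℂ × ℂ) := {b} ×ˢ closedBall (0 : ℂ) R with hs
  have hsc : IsCompact s := isCompact_singleton.prod (isCompact_closedBall 0 R)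
  have hsub : s ⊆ ball b δ ×ˢ univ := by
    rintro ⟨a, z⟩ ⟨ha, -⟩
    exact ⟨by rw [mem_singleton_iff.1 ha]; exact mem_ball_self hδ, mem_univ _⟩
  have hinjs : InjOn Φ s := by
    rintro ⟨a, z⟩ ⟨ha, -⟩ ⟨a', z'⟩ ⟨ha', -⟩ h
    simp only [mem_singleton_iff] at ha ha'
    subst ha ha'
    exact Prod.ext rfl (hinj h)
  have hcont : ∀ q ∈ s, ContinuousAt Φ q := fun q hq =>
    (hΦ.continuousOn.continuousWithinAt (hsub hq)).continuousAt (hopen.mem_nhds (hsub hq))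
  have hloc : ∀ q ∈ s, ∃ N ∈ 𝓝 q, InjOn Φ N := fun q hq =>
    exists_mem_nhds_injOn hopen hΦ (hsub hq) (himm q (hsub hq))
  obtain ⟨t, hto, hst, hinjt⟩ := hinjs.exists_isOpen_superset hsc hcont hloc
  obtain ⟨u₁, v₁, hu₁, hv₁, hbu, hRv, huv⟩ :=
    generalized_tube_lemma isCompact_singleton (isCompact_closedBall (0 : ℂ) R) hto hst
  have hb : b ∈ u₁ := hbu (mem_singleton b)
  obtain ⟨δ₁, hδ₁, hδ₁u⟩ := Metric.isOpen_iff.1 hu₁ b hb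
  refine ⟨min δ₁ δ, lt_min hδ₁ hδ, min_le_right _ _, hinjt.mono ?_⟩
  rintro ⟨a, z⟩ ⟨ha, hz⟩
  exact huv ⟨hδ₁u (ball_subset_ball (min_le_left _ _) ha), hRv (ball_subset_closedBall hz)⟩

omit [IsManifold (𝓡 4) ∞ X] in
/-- An injective differential `ℂ × ℂ → T_y X` (`dim X = 4`) is bijective (restated from
`bijective_of_injective_mfderiv`). [folklore] -/
theorem bijective_mfderiv_of_injective {q : ℂ × ℂ}
    (h : Injective (mfderiv 𝓘(ℝ, ℂ × ℂ) (𝓡 4) Φ q)) :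
    Bijective (mfderiv 𝓘(ℝ, ℂ × ℂ) (𝓡 4) Φ q) :=
  bijective_of_injective_mfderiv h

/-- **The leaf function near a compact core**: `A = pr₁ ∘ Φ⁻¹` on `Φ '' D`. [cite: Wendl2018, Prop. 2.53 (proof, p. 66)] -/
def coreLeafFn (Φ : ℂ × ℂ → X) (D : Set (ℂ × ℂ)) (y : X) : ℂ :=
  (invFunOn Φ D y).1

variable {D : Set (ℂ × ℂ)}

omit [TopologicalSpace X] [ChartedSpace (EuclideanSpace ℝ (Fin 4)) X] [IsManifold (𝓡 4) ∞ X] in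
/-- `A (Φ q) = q.1` on the box. [folklore] -/
theorem coreLeafFn_apply (hinj : InjOn Φ D) {q : ℂ × ℂ} (hq : q ∈ D) :
    coreLeafFn Φ D (Φ q) = q.1 := by
  rw [coreLeafFn, Literature.Geometry.Manifold.invFunOn_apply hinj hq]

omit [TopologicalSpace X] [ChartedSpace (EuclideanSpace ℝ (Fin 4)) X] [IsManifold (𝓡 4) ∞ X] in
/-- **The level sets of the leaf function are the leaves**: for `D = B × C` and `b' ∈ B`,
`{y ∈ Φ '' D | A y = b'} = Φ '' ({b'} × C)`. [cite: Wendl2018, Prop. 2.53] -/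
theorem coreLeafFn_levelSet {B C : Set ℂ} (hinj : InjOn Φ (B ×ˢ C)) {b' : ℂ} (hb' : b' ∈ B) :
    {y | y ∈ Φ '' (B ×ˢ C) ∧ coreLeafFn Φ (B ×ˢ C) y = b'} = Φ '' ({b'} ×ˢ C) := by
  apply Subset.antisymm
  · rintro y ⟨⟨q, hq, rfl⟩, hA⟩
    rw [coreLeafFn_apply hinj hq] at hA
    exact ⟨q, ⟨by rw [mem_singleton_iff]; exact hA, hq.2⟩, rfl⟩
  · rintro y ⟨q, ⟨hq1, hq2⟩, rfl⟩
    rw [mem_singleton_iff] at hq1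
    have hq : q ∈ B ×ˢ C := ⟨by rw [hq1]; exact hb', hq2⟩
    exact ⟨⟨q, hq, rfl⟩, by rw [coreLeafFn_apply hinj hq, hq1]⟩

/-- The image of an open box under the immersive family is open. [cite: LeeSmoothManifolds2013, Prop. 4.8] -/
theorem isOpen_image_of_immersive (hD : IsOpen D) (hΦ : ContMDiffOn 𝓘(ℝ, ℂ × ℂ) (𝓡 4) ∞ Φ D)
    (himm : ∀ q ∈ D, Injective (mfderiv 𝓘(ℝ, ℂ × ℂ) (𝓡 4) Φ q)) : IsOpen (Φ '' D) :=
  Literature.Geometry.Manifold.isOpen_image_of_bijective_mfderiv hD hΦ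
    fun q hq => bijective_mfderiv_of_injective (himm q hq)

/-- `Φ⁻¹` is smooth on the image of an injectivity box. [cite: LeeSmoothManifolds2013, Thm. 4.5] -/
theorem contMDiffOn_invFunOn_of_immersive (hD : IsOpen D)
    (hΦ : ContMDiffOn 𝓘(ℝ, ℂ × ℂ) (𝓡 4) ∞ Φ D) (hinj : InjOn Φ D)
    (himm : ∀ q ∈ D, Injective (mfderiv 𝓘(ℝ, ℂ × ℂ) (𝓡 4) Φ q)) :
    ContMDiffOn (𝓡 4) 𝓘(ℝ, ℂ × ℂ) ∞ (invFunOn Φ D) (Φ '' D) :=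
  Literature.Geometry.Manifold.contMDiffOn_invFunOn_of_bijective_mfderiv hD hΦ hinj
    fun q hq => bijective_mfderiv_of_injective (himm q hq)

/-- **The leaf function is smooth** on the image of an injectivity box. [cite: Wendl2018, Prop. 2.53] -/
theorem contMDiffOn_coreLeafFn (hD : IsOpen D) (hΦ : ContMDiffOn 𝓘(ℝ, ℂ × ℂ) (𝓡 4) ∞ Φ D)
    (hinj : InjOn Φ D) (himm : ∀ q ∈ D, Injective (mfderiv 𝓘(ℝ, ℂ × ℂ) (𝓡 4) Φ q)) :
    ContMDiffOn (𝓡 4) 𝓘(ℝ, ℂ) ∞ (coreLeafFn Φ D) (Φ '' D) := by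
  have h := contMDiffOn_invFunOn_of_immersive hD hΦ hinj himm
  exact fun y hy => contDiff_fst.comp_contMDiffWithinAt (h y hy)

/-- **`dA ∘ dΦ = pr₁`** on the injectivity box (chain rule on `A ∘ Φ = pr₁`).
[cite: Wendl2018, Prop. 2.53 (proof, p. 66)] -/
theorem mfderiv_coreLeafFn_comp (hD : IsOpen D) (hΦ : ContMDiffOn 𝓘(ℝ, ℂ × ℂ) (𝓡 4) ∞ Φ D)
    (hinj : InjOn Φ D) (himm : ∀ q ∈ D, Injective (mfderiv 𝓘(ℝ, ℂ × ℂ) (𝓡 4) Φ q))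
    {q : ℂ × ℂ} (hq : q ∈ D) :
    (mfderiv (𝓡 4) 𝓘(ℝ, ℂ) (coreLeafFn Φ D) (Φ q)).comp (mfderiv 𝓘(ℝ, ℂ × ℂ) (𝓡 4) Φ q) =
      ContinuousLinearMap.fst ℝ ℂ ℂ := by
  have hA : MDifferentiableAt (𝓡 4) 𝓘(ℝ, ℂ) (coreLeafFn Φ D) (Φ q) :=
    ((contMDiffOn_coreLeafFn hD hΦ hinj himm).contMDiffAt
      ((isOpen_image_of_immersive hD hΦ himm).mem_nhds ⟨q, hq, rfl⟩)).mdifferentiableAt (by simp)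
  have hΦd : MDifferentiableAt 𝓘(ℝ, ℂ × ℂ) (𝓡 4) Φ q :=
    (hΦ.contMDiffAt (hD.mem_nhds hq)).mdifferentiableAt (by simp)
  rw [← mfderiv_comp q hA hΦd]
  have heq : (coreLeafFn Φ D ∘ Φ) =ᶠ[𝓝 q] Prod.fst := by
    filter_upwards [hD.mem_nhds hq] with q' hq'
    exact coreLeafFn_apply hinj hq'
  rw [heq.mfderiv_eq, mfderiv_eq_fderiv, fderiv_fst]

/-- **The leaf function is a submersion** on the image of the box. [cite: Wendl2018, Prop. 2.53] -/
theorem surjective_mfderiv_coreLeafFn (hD : IsOpen D) (hΦ : ContMDiffOn 𝓘(ℝ, ℂ × ℂ) (𝓡 4) ∞ Φ D)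
    (hinj : InjOn Φ D) (himm : ∀ q ∈ D, Injective (mfderiv 𝓘(ℝ, ℂ × ℂ) (𝓡 4) Φ q))
    {q : ℂ × ℂ} (hq : q ∈ D) :
    Surjective (mfderiv (𝓡 4) 𝓘(ℝ, ℂ) (coreLeafFn Φ D) (Φ q)) := by
  intro c
  have h := congrArg (fun T : ℂ × ℂ →L[ℝ] ℂ => T (c, 0)) (mfderiv_coreLeafFn_comp hD hΦ hinj himm hq)
  exact ⟨mfderiv 𝓘(ℝ, ℂ × ℂ) (𝓡 4) Φ q (c, 0), h⟩

/-- **The leaf function kills the tangent planes of the leaves**: `dA (dΦ (0, v)) = 0`.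
[cite: Wendl2018, Prop. 2.53] -/
theorem mfderiv_coreLeafFn_slice_eq_zero (hD : IsOpen D)
    (hΦ : ContMDiffOn 𝓘(ℝ, ℂ × ℂ) (𝓡 4) ∞ Φ D) (hinj : InjOn Φ D)
    (himm : ∀ q ∈ D, Injective (mfderiv 𝓘(ℝ, ℂ × ℂ) (𝓡 4) Φ q)) {q : ℂ × ℂ} (hq : q ∈ D) (v : ℂ) :
    mfderiv (𝓡 4) 𝓘(ℝ, ℂ) (coreLeafFn Φ D) (Φ q) (mfderiv 𝓘(ℝ, ℂ × ℂ) (𝓡 4) Φ q (0, v)) = 0 := by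
  have h := congrArg (fun T : ℂ × ℂ →L[ℝ] ℂ => T (0, v)) (mfderiv_coreLeafFn_comp hD hΦ hinj himm hq)
  exact h

/-- **The kernel of `dA` is exactly the tangent plane of the leaf**: `dA w = 0` iff
`w = dΦ (0, v)` for some `v`. [cite: Wendl2018, Prop. 2.53] -/
theorem mfderiv_coreLeafFn_eq_zero_iff (hD : IsOpen D)
    (hΦ : ContMDiffOn 𝓘(ℝ, ℂ × ℂ) (𝓡 4) ∞ Φ D) (hinj : InjOn Φ D)
    (himm : ∀ q ∈ D, Injective (mfderiv 𝓘(ℝ, ℂ × ℂ) (𝓡 4) Φ q)) {q : ℂ × ℂ} (hq : q ∈ D)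
    (w : TangentSpace (𝓡 4) (Φ q)) :
    mfderiv (𝓡 4) 𝓘(ℝ, ℂ) (coreLeafFn Φ D) (Φ q) w = 0 ↔
      ∃ v : ℂ, w = mfderiv 𝓘(ℝ, ℂ × ℂ) (𝓡 4) Φ q (0, v) := by
  constructor
  · intro hw
    obtain ⟨⟨c, v⟩, rfl⟩ := (bijective_mfderiv_of_injective (himm q hq)).2 w
    have h := congrArg (fun T : ℂ × ℂ →L[ℝ] ℂ => T (c, v)) (mfderiv_coreLeafFn_comp hD hΦ hinj himm hq)
    have hc : c = 0 := (h.symm.trans hw : c = 0)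
    subst hc
    exact ⟨v, rfl⟩
  · rintro ⟨v, rfl⟩
    exact mfderiv_coreLeafFn_slice_eq_zero hD hΦ hinj himm hq v

omit [IsManifold (𝓡 4) ∞ X] in
/-- The differential of a slice `ξ ↦ Φ (b', ξ)` is `dΦ (b', ξ) ∘ inr`. [folklore] -/
theorem hasMFDerivAt_slice_of_mem (hD : IsOpen D) (hΦ : ContMDiffOn 𝓘(ℝ, ℂ × ℂ) (𝓡 4) ∞ Φ D)
    {b' ξ : ℂ} (hq : (b', ξ) ∈ D) :
    HasMFDerivAt 𝓘(ℝ, ℂ) (𝓡 4) (fun ξ' : ℂ => Φ (b', ξ')) ξ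
      ((mfderiv 𝓘(ℝ, ℂ × ℂ) (𝓡 4) Φ (b', ξ)).comp (ContinuousLinearMap.inr ℝ ℂ ℂ)) := by
  have hΦd : MDifferentiableAt 𝓘(ℝ, ℂ × ℂ) (𝓡 4) Φ (b', ξ) :=
    (hΦ.contMDiffAt (hD.mem_nhds hq)).mdifferentiableAt (by simp)
  have hi : HasMFDerivAt 𝓘(ℝ, ℂ) 𝓘(ℝ, ℂ × ℂ) (fun ξ' : ℂ => (b', ξ')) ξ
      (ContinuousLinearMap.inr ℝ ℂ ℂ) :=
    ((hasFDerivAt_prodMk_right (𝕜 := ℝ) b' ξ)).hasMFDerivAt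
  exact hΦd.hasMFDerivAt.comp ξ hi

omit [IsManifold (𝓡 4) ∞ X] in
/-- `d(Φ (b', ·))(ξ) v = dΦ (b', ξ) (0, v)`. [folklore] -/
theorem mfderiv_slice_apply_of_mem (hD : IsOpen D) (hΦ : ContMDiffOn 𝓘(ℝ, ℂ × ℂ) (𝓡 4) ∞ Φ D)
    {b' ξ : ℂ} (hq : (b', ξ) ∈ D) (v : ℂ) :
    mfderiv 𝓘(ℝ, ℂ) (𝓡 4) (fun ξ' : ℂ => Φ (b', ξ')) ξ v =
      mfderiv 𝓘(ℝ, ℂ × ℂ) (𝓡 4) Φ (b', ξ) (0, v) := by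
  rw [(hasMFDerivAt_slice_of_mem hD hΦ hq).mfderiv]
  rfl

/-- **Complex linearisation of the leaf function at a point of a `J`-holomorphic leaf.** If
`J_y² = −1` at `y = Φ q` and the slice through `q` is `J`-holomorphic there
(`dΦ_q (0, i w) = J_y dΦ_q (0, w)`), then `ker dA_y` (the tangent plane of the leaf) is
`J_y`-invariant, so there are `α, β` with `|α| ≠ |β|` making `v ↦ α dA_y v + β conj (dA_y v)`
complex linear for `J_y`, with `|β| < |α|` iff `Im (dA_y (J_y v) conj (dA_y v)) > 0` off the
kernel (`exists_complexLinearisation`). [cite: Wendl2018, Prop. 2.53 with Thm. 2.49] -/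
theorem exists_complexLinearisation_coreLeafFn (hD : IsOpen D)
    (hΦ : ContMDiffOn 𝓘(ℝ, ℂ × ℂ) (𝓡 4) ∞ Φ D) (hinj : InjOn Φ D)
    (himm : ∀ q ∈ D, Injective (mfderiv 𝓘(ℝ, ℂ × ℂ) (𝓡 4) Φ q)) {q : ℂ × ℂ} (hq : q ∈ D)
    (Jy : TangentSpace (𝓡 4) (Φ q) →L[ℝ] TangentSpace (𝓡 4) (Φ q))
    (hJ2 : ∀ v, Jy (Jy v) = -v)
    (hhol : ∀ w : ℂ, mfderiv 𝓘(ℝ, ℂ × ℂ) (𝓡 4) Φ q (0, Complex.I * w) =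
      Jy (mfderiv 𝓘(ℝ, ℂ × ℂ) (𝓡 4) Φ q (0, w))) :
    ∃ α β : ℂ, ‖α‖ ≠ ‖β‖ ∧
      (∀ v, α * (show ℂ from mfderiv (𝓡 4) 𝓘(ℝ, ℂ) (coreLeafFn Φ D) (Φ q) (Jy v)) +
          β * (starRingEnd ℂ) (show ℂ from mfderiv (𝓡 4) 𝓘(ℝ, ℂ) (coreLeafFn Φ D) (Φ q) (Jy v)) =
        Complex.I * (α * (show ℂ from mfderiv (𝓡 4) 𝓘(ℝ, ℂ) (coreLeafFn Φ D) (Φ q) v) +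
          β * (starRingEnd ℂ) (show ℂ from mfderiv (𝓡 4) 𝓘(ℝ, ℂ) (coreLeafFn Φ D) (Φ q) v))) ∧
      (∀ v, (show ℂ from mfderiv (𝓡 4) 𝓘(ℝ, ℂ) (coreLeafFn Φ D) (Φ q) v) ≠ 0 →
        (‖β‖ < ‖α‖ ↔ 0 < ((show ℂ from mfderiv (𝓡 4) 𝓘(ℝ, ℂ) (coreLeafFn Φ D) (Φ q) (Jy v)) *
          (starRingEnd ℂ) (show ℂ from mfderiv (𝓡 4) 𝓘(ℝ, ℂ) (coreLeafFn Φ D) (Φ q) v)).im)) ∧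
      (∀ v, (show ℂ from mfderiv (𝓡 4) 𝓘(ℝ, ℂ) (coreLeafFn Φ D) (Φ q) v) ≠ 0 →
        (‖α‖ < ‖β‖ ↔ ((show ℂ from mfderiv (𝓡 4) 𝓘(ℝ, ℂ) (coreLeafFn Φ D) (Φ q) (Jy v)) *
          (starRingEnd ℂ) (show ℂ from mfderiv (𝓡 4) 𝓘(ℝ, ℂ) (coreLeafFn Φ D) (Φ q) v)).im < 0)) := by
  set L : TangentSpace (𝓡 4) (Φ q) →L[ℝ] ℂ := mfderiv (𝓡 4) 𝓘(ℝ, ℂ) (coreLeafFn Φ D) (Φ q) with hL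
  have hker : ∀ v, L v = 0 → L (Jy v) = 0 := by
    intro v hv
    obtain ⟨w, rfl⟩ := (mfderiv_coreLeafFn_eq_zero_iff hD hΦ hinj himm hq v).1 hv
    rw [← hhol w]
    exact mfderiv_coreLeafFn_slice_eq_zero hD hΦ hinj himm hq _
  have hsurj : Surjective L := surjective_mfderiv_coreLeafFn hD hΦ hinj himm hq
  exact exists_complexLinearisation Jy.toLinearMap L.toLinearMap hJ2 hker hsurj

end Core

end Literature.Geometry.Symplectic
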